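import Summits.BirchSwinnertonDyer.Rank1Residual.X11b.Three.JetchevShapeOverK
import Literature.NumberTheory.EllipticCurves.NeronIsogenyScalingHoldsProofs
import HarnessLib

/-!
# Class X11b at `p = 3` (team N8/O2 = cell `b2b-bsdres`, seat x11b3-p8, lead deal #4 (R2), S12), file 3/3:
# what the PRINTED irreducible-image Kolyvagin bound (Matar–Nekovář 2019 / Cha 2005) buys on the (T4″)@3 corner

HONEST FRAMING (verbatim, cell `b2b-bsdres`, run/shared/lean/b2b/bsd-rank1-residual/): the goal of
the cell is to DELETE the COMBINATION-SHAPED residual classes for ALL analytic-rank `≤ 1` curves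
over `ℚ` — "full BSD formula for every rank `≤ 1` curve in class `C`" assembled STRICTLY from
published theorems — so that the rank-`≤ 1` remainder becomes exactly the CONSTRUCTION-SHAPED
classes, which are TYPED (missing-input Props), NOT attempted; this is not "finishing BSD".
Research route; nothing booked; NO label changes; census numbers are EVIDENCE (x11b3-p6's CORNER
CENSUS, `cells/x11b3/CORNER-CENSUS.md`, two engines), never facts. THEOREMS ONLY (no definition,
no named fact, no `sorry`).

## What this file does

Lead deal #4 (R2) named, as the printed irreducible-image substitute for the `Surj`-carrying
Euler-system binder on the corner, "Cha 2005 Thm 21 'ℓ ∤ D_K, good or multiplicative at ℓ' ✓ at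
3 ∥ N + MN19 §0.11 / Prop 5.26(2) / Cor 5.21(e′)". The tree HOLDS that substitute as a named fact:
`MatarNekovar2019.thm03_padicValNat_card_sha_le_of_irreducible` (Kolyvagin's bound
`ord_p #Ш(E/K) ≤ 2·ord_p [E(K):ℤy_K]` under (irr), `p ≠ 2`, `d_K ∉ {−3,−4}`; no hypothesis at `p`, no
(ram), no `Surj`). This file records EXACTLY what it delivers for an X11b@3 pair (only (irr) used):
* `padicValNat_shaOrder_le_add_of_matarNekovar` — the DEFECT form
  `ord₃ #Ш(E) ≤ ord₃ #Ш(E)_an + 2·ord₃ ∏_ℓ c_ℓ(E)` from PUBLISHED facts + the fact + ONE typed input,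
  the twist's `≥`-half at the odd-`d_K` Heegner data (road (b) gets it from Skinner 2016 Thm. C via
  (ram); void on the corner, where `¬Ram`);
* `missingUpperBoundAt_of_matarNekovar_of_not_dvd` — on `3 ∤ ∏_ℓ c_ℓ(E)` the defect vanishes:
  the Euler-system half `Typed.MissingUpperBoundAt W 3` with NO image / (ram) binder beyond the
  twist's `≥`-half. On the corner this is CORNER-CENSUS (C1): 88 class-pairs, ALL non-split at `3`
  (offered to x11b3-p3 for the binder `hCn` of `Three.forall_bsdp_of_classRecord`).
On corner ∧ SPLIT(3) the defect is `≥ 2·ord₃ c₃ ≥ 2` (`shapeAlpha_of_corner_split`, file 1/3): the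
printed substitute does NOT close the upper half there, whence the Tamagawa-sharp conjunct (R-U♯) of
`CornerSplitResidualAt` (file 1/3). CONDITIONAL; nothing booked; O2 OPEN.

References: [MatarNekovar2019] Thm. 0.3 (p. 456), §0.4, §0.11 (p. 457), Prop. 5.26 (2) (p. 492),
Cor. 5.21 (e′) (pp. 490–491); [Cha2005] Thm. 21, Rmk. 25 (pp. 173–175); [JetchevSkinnerWan2017]
§7.4.2; [McCallumLMS1991] §1; [HoffsteinLuo1997]; [Mazur1978] Cor. 4.1; [Miller2011LMS] Def. 1.1;
harvest-2 GEN 31 `E69-REVIEW-T-LOWKS-irr.md` (page audit of MN19 / Cha / McCallum).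
-/

noncomputable section

open scoped Classical

open WeierstrassCurve NumberField Literature.NumberTheory.EllipticCurves
  Literature.NumberTheory.EllipticCurves.ModularForms
  Literature.NumberTheory.EllipticCurves.Rank1Residual
  Literature.NumberTheory.EllipticCurves.Rank1Residual.Typed

namespace Summit.BirchSwinnertonDyer.Rank1Residual.X11b.Three

/-! ### §4. What the PRINTED irreducible-image Kolyvagin bound buys (Matar–Nekovář 2019 / Cha 2005) -/

/-- **The Euler-system half on X11b@3 from the PRINTED irreducible-image Kolyvagin bound — DEFECT
form: `ord₃ #Ш(E) ≤ ord₃ #Ш(E)_an + 2·ord₃ ∏_ℓ c_ℓ(E)`, NO `Surj`, NO (ram).** For every X11b@3 pair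
(only (irr) is used): PUBLISHED binders Gross–Zagier, Kolyvagin (finiteness), GZK, modularity,
newform, Hoffstein–Luo, Mazur 1978 Cor. 4.1 (the odd-`d_K` Manin-good Heegner data,
`exists_oddHeegnerData`) and **Matar–Nekovář 2019 Thm. 0.3 + §0.11** (`hMN`, tree fact
`MatarNekovar2019.thm03_padicValNat_card_sha_le_of_irreducible`: `ord₃ #Ш(E/K) ≤ 2·ord₃ [E(K):ℤy_K]`
for `d_K ∉ {−3,−4}`, `E[3]` irreducible — the irreducible-image substitute for McCallum 1991 §1;
Cha 2005 Thm. 21 is the same at `3 ∥ N`, `3 ∤ D_K`); and ONE typed input, the twist's `≥`-half at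
those data (`htw`; road (b) gets it from Skinner 2016 Thm. C via (ram) — void on the corner).
CONCLUSION: the defect form (multr1-p2's `padicValNat_shaOrder_le_add_of_shaIndexBound`). On the
(T4″)@3 corner this is ALL the printed substitute delivers: on corner ∧ split the defect is
`≥ 2·ord₃ c₃ ≥ 2` (`shapeAlpha_of_corner_split`, file 1/3); on corner ∧ `3 ∤ ∏c` it is `0`
(`missingUpperBoundAt_of_matarNekovar_of_not_dvd`). CONDITIONAL on `htw`; nothing booked.
[cite: MatarNekovar2019, Thm. 0.3 (p. 456), §0.11 (p. 457), Prop. 5.26 (2) (p. 492), Cor. 5.21 (e′) (pp. 490–491)]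
[cite: Cha2005, Thm. 21 and Remark 25 (pp. 173–175)] [cite: JetchevSkinnerWan2017, §7.4.2 (p. 31)]
[cite: Mazur1978, Cor. 4.1] [cite: Miller2011LMS, Def. 1.1] -/
theorem padicValNat_shaOrder_le_add_of_matarNekovar [Fact (Nat.Prime 3)]
    (hGZ : ∀ (N : ℕ) [NeZero N] (W : WeierstrassCurve ℚ) (K : Type) [Field K] [NumberField K],
      gross_zagier N W K)
    (hKo : ∀ (N : ℕ) [NeZero N] (W : WeierstrassCurve ℚ) (K : Type) [Field K] [NumberField K],
      kolyvagin N W K)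
    (hGZK : rank_eq_analyticRank_of_analyticRank_le_one) (hmod : hasEntireLFunction_rat)
    (hnf : exists_isNewformOf) (hHL : HoffsteinLuo1997_exists_twist_L_one_ne_zero)
    (hMaz : mazur_not_dvd_maninConstant_of_odd)
    (hMN : ∀ (N : ℕ) [NeZero N] (W : WeierstrassCurve ℚ) (K : Type) [Field K] [NumberField K],
      MatarNekovar2019.thm03_padicValNat_card_sha_le_of_irreducible N W K)
    (W : WeierstrassCurve ℚ) [W.IsElliptic] [W.IsGloballyMinimal] (hX : ClassX11b W 3)
    -- the twist's `≥`-half at the odd-`d_K` Manin-good Heegner data of the pair (typed; no (ram))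
    (htw : ∀ (K : Type) [Field K] [NumberField K]
      (Wd : WeierstrassCurve ℚ) [Wd.IsElliptic] [Wd.IsGloballyMinimal] (Cd : VariableChange ℚ),
      IsImaginaryQuadratic K → Odd (NumberField.discr K) →
      SatisfiesHeegnerHypothesis (W.conductorNorm ℤ) K →
      (W.quadraticTwist (NumberField.discr K : ℚ)).entireLFunction 1 ≠ 0 →
      Cd • W.quadraticTwist (NumberField.discr K : ℚ) = Wd →
      ∃ q : ℚ, Wd.entireLFunction 1 / (Wd.realPeriodRat : ℂ) = (q : ℂ) ∧
        padicValRat 3 q ≤ (padicValNat 3 Wd.shaOrder : ℤ) + padicValNat 3 Wd.tamagawaProduct -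
          2 * padicValNat 3 Wd.torsionOrder) :
    ∃ q : ℚ, shaAn W = (q : ℂ) ∧
      (padicValNat 3 W.shaOrder : ℤ) ≤ padicValRat 3 q + 2 * padicValNat 3 W.tamagawaProduct := by
  have hNS : integral_neronScaling_of_isGloballyMinimal :=
    integral_neronScaling_of_isGloballyMinimal_holds
  obtain ⟨hr, hp2, hmult, hirr⟩ := hX
  haveI : NeZero (W.conductorNorm ℤ) := ⟨(W.conductorNorm_pos_holds).ne'⟩
  obtain ⟨K, _, _, Dt, H, ι, P, Wd, _, _, Cd, hK, hodd, hpd, hHN, hP, hc, hμ, hLt, hWd⟩ :=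
    exists_oddHeegnerData hnf hHL hMaz hNS W 3 hr hp2 hmult hirr
  have htam : padicValNat 3 Wd.tamagawaProduct = padicValNat 3 W.tamagawaProduct :=
    X2.padicValNat_tamagawaProduct_twist_of_heegner_of_odd W 3 hp2 K hK hodd hpd hHN Cd hWd
  have hu : padicValRat 3 (Cd.u : ℚ) = 0 :=
    padicValRat_u_eq_zero_of_twist_minimal W 3 K hK hHN hmult Cd hWd
  -- `d_K ∉ {−3, −4}`: `3 ∤ d_K` and `d_K` odd
  have hD3 : NumberField.discr K ≠ -3 := by
    intro h; apply hpd; rw [h]; norm_num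
  have hD4 : NumberField.discr K ≠ -4 := by
    intro h; rw [h] at hodd; obtain ⟨k, hk⟩ := hodd; omega
  exact padicValNat_shaOrder_le_add_of_shaIndexBound W 3 (W.conductorNorm ℤ) K Dt H ι P (hGZ _ W K)
    (hKo _ W K) hGZK hmod hK hHN hP hp2 hc hμ hr hLt Wd Cd hWd hu htam (htw K Wd Cd hK hodd hHN hLt hWd)
    (fun _ hPinf ↦ hMN _ W K hK hHN hD3 hD4 ⟨Dt, H, ι, hP⟩ hPinf Fact.out hp2 hirr)

/-- **Corner ∧ `3 ∤ ∏_ℓ c_ℓ(E)` (CORNER-CENSUS (C1): 88 class-pairs, all NON-split at `3`): the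
Euler-system half `ord₃ #Ш(E) ≤ ord₃ #Ш(E)_an` from PUBLISHED facts incl. Matar–Nekovář 2019 + the
twist's `≥`-half ONLY** — the defect of `padicValNat_shaOrder_le_add_of_matarNekovar` vanishes. For
x11b3-p3's binder `hCn` (S11): on (C1) the upper half needs no image/(ram) binder beyond `htw`; the
lower half there is (R-L) + the twist's `≤`-half as on the split corner. Holds for every X11b@3 pair
with `3 ∤ ∏c` (on (ram) ∧ `3 ∤ ∏c` = A1 it is weaker than multr1-p2's unconditional
`missingUpperBoundAt_of_classX11b_of_ram_of_not_dvd`). CONDITIONAL on `htw`; nothing booked.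
[cite: MatarNekovar2019, Thm. 0.3 (p. 456) and §0.11 (p. 457)] [cite: Cha2005, Thm. 21 (p. 173)]
[cite: JetchevSkinnerWan2017, §7.4.2 (eq:shaupper), p. 31] [cite: Miller2011LMS, Def. 1.1] -/
theorem missingUpperBoundAt_of_matarNekovar_of_not_dvd [Fact (Nat.Prime 3)]
    (hGZ : ∀ (N : ℕ) [NeZero N] (W : WeierstrassCurve ℚ) (K : Type) [Field K] [NumberField K],
      gross_zagier N W K)
    (hKo : ∀ (N : ℕ) [NeZero N] (W : WeierstrassCurve ℚ) (K : Type) [Field K] [NumberField K],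
      kolyvagin N W K)
    (hGZK : rank_eq_analyticRank_of_analyticRank_le_one) (hmod : hasEntireLFunction_rat)
    (hnf : exists_isNewformOf) (hHL : HoffsteinLuo1997_exists_twist_L_one_ne_zero)
    (hMaz : mazur_not_dvd_maninConstant_of_odd)
    (hMN : ∀ (N : ℕ) [NeZero N] (W : WeierstrassCurve ℚ) (K : Type) [Field K] [NumberField K],
      MatarNekovar2019.thm03_padicValNat_card_sha_le_of_irreducible N W K)
    (W : WeierstrassCurve ℚ) [W.IsElliptic] [W.IsGloballyMinimal] (hX : ClassX11b W 3)
    (htam0 : ¬ 3 ∣ W.tamagawaProduct)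
    (htw : ∀ (K : Type) [Field K] [NumberField K]
      (Wd : WeierstrassCurve ℚ) [Wd.IsElliptic] [Wd.IsGloballyMinimal] (Cd : VariableChange ℚ),
      IsImaginaryQuadratic K → Odd (NumberField.discr K) →
      SatisfiesHeegnerHypothesis (W.conductorNorm ℤ) K →
      (W.quadraticTwist (NumberField.discr K : ℚ)).entireLFunction 1 ≠ 0 →
      Cd • W.quadraticTwist (NumberField.discr K : ℚ) = Wd →
      ∃ q : ℚ, Wd.entireLFunction 1 / (Wd.realPeriodRat : ℂ) = (q : ℂ) ∧
        padicValRat 3 q ≤ (padicValNat 3 Wd.shaOrder : ℤ) + padicValNat 3 Wd.tamagawaProduct -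
          2 * padicValNat 3 Wd.torsionOrder) :
    Typed.MissingUpperBoundAt W 3 := by
  obtain ⟨q, hq, hle⟩ :=
    padicValNat_shaOrder_le_add_of_matarNekovar hGZ hKo hGZK hmod hnf hHL hMaz hMN W hX htw
  refine ⟨q, hq, ?_⟩
  have h0 : padicValNat 3 W.tamagawaProduct = 0 := padicValNat.eq_zero_of_not_dvd htam0
  have e0 : (padicValNat 3 W.tamagawaProduct : ℤ) = 0 := by exact_mod_cast h0
  omega

end Summit.BirchSwinnertonDyer.Rank1Residual.X11b.Three

end
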